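import Literature.NumberTheory.EllipticCurves.Castella2018.MultiplicativePPartErratum
import Literature.NumberTheory.EllipticCurves.BSDSelmerCMPConverseRankOneProofs
import Literature.NumberTheory.EllipticCurves.Selmer
import HarnessLib

/-!
# Castella 2024 (arXiv:2409.01360v1, UNREFEREED), Theorem 1.1 and Corollary 1.2: the `p`-converse
# to Gross–Zagier–Kolyvagin at a prime `p > 3` of MULTIPLICATIVE reduction with `E[p]` IRREDUCIBLE

HONEST FRAMING (cross-ladder LITERATURE-TYPING layer D-0088(4), cell `bsd-littype`, seat
`bsd-littype-11`): this file TYPES the main theorem of a PREPRINT as an explicitly labelled OPEN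
hypothesis (`def … : Prop`, suffix `_OPEN`, tag `[claim: …, status: under-review]`), NEVER as a
theorem — exactly as the tree does for the other multiplicative `p`-converse in print-but-unrefereed
form, Skinner–Zhang arXiv:1407.1099 Thm. 1.1 (`SkinnerZhang2014.thm1_1_rank_one_of_selmerCorank_eq_one_OPEN`),
and for the same author's erratum Theorem A′ (`Castella2018.erratum_thmAprime_padicVal_bsd_rankOne_OPEN`,
whose binders (i)–(iii) below are copied VERBATIM so that consumers can feed both from one
hypothesis check). Typed ≠ proved ≠ endorsed; every result using the `Prop` is CONDITIONAL on an
unrefereed claim («literal-PRE»); nothing about any curve is asserted; BSD is not proved by any of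
this. D-0026 accounting: ONE new named `Prop` (claim-tagged); Corollary 1.2 is PROVED from it (and
the tree's Cassels–Tate fact), not vendored as a second hypothesis.

## Source (READ by this seat 2026-08-26 on the store's LaTeXML text `paper:arxiv-2409.01360`, 12 chunks)

F. Castella, *Exceptional zeros for Heegner points and `p`-converse to the theorem of Gross–Zagier
and Kolyvagin*, arXiv:2409.01360v1 (2 Sep 2024), 11 pp. [Castella2024]. **STATUS: PREPRINT**
(arXiv v1 only; no journal version located as of 2026-08-26 — `lit search` this session:
arXiv/zbMATH list the e-print only; `lean/references.bib` note "unrefereed as of August 2026").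

§1.1 "Main results" (`[corpus: paper:arxiv-2409.01360 p0003:L5–L34]`), verbatim:

> The main result of this note is the following `p`-converse to the theorem of Gross–Zagier and
> Kolyvagin for rational elliptic curves at primes `p` of multiplicative reduction.
> **Theorem 1.1.** Let `E/ℚ` be an elliptic curve with multiplicative reduction at the prime
> `p > 3`. Assume that (i) `E[p]` is irreducible as a `G_ℚ := Gal(ℚ̄/ℚ)`-module, (ii) `E` has
> nonsplit multiplicative reduction at some prime `q ≠ p` where `E[p]` is ramified, (iii)
> `E(ℚ_p)[p] = 0`. Then `corank_{ℤ_p} Sel_{p^∞}(E/ℚ) = 1 ⟹ ord_{s=1} L(E,s) = 1`, and so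
> `rank_ℤ E(ℚ) = 1` and `#Ш(E/ℚ) < ∞`.
> **Corollary 1.2.** Let `E/ℚ` be an elliptic curve with multiplicative reduction at the prime
> `p > 3` satisfying conditions (i)–(iii) in Theorem 1.1. If the `p`-Selmer group
> `Sel_p(E/ℚ) ⊂ H¹(ℚ,E[p])` has order `p`, then `rank_ℤ E(ℚ) = ord_{s=1} L(E,s) = 1` and
> `#Ш(E/ℚ) < ∞`; in particular, the Birch–Swinnerton-Dyer conjecture holds for `E`.
> *Proof.* This is immediate from Theorem 1.1 and the existence of the alternating Cassels–Tate
> pairing on the quotient of `Sel_{p^∞}(E/ℚ)` by its maximal divisible subgroup (see [majority] for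
> details, and note that the argument also shows `Ш(E/ℚ)[p^∞] = 0`). □

PROVENANCE CHAIN (why `_OPEN`; `[ibid. p0003:L44 – p0004:L4]`): "We deduce Theorem 1.1 from the
proof of a new variant of Perrin-Riou's Heegner point main conjecture [PR-HP] reflecting the presence
of 'exceptional zeros' … in the split multiplicative case" = the paper's **Theorem 1.3** (for `K`
imaginary quadratic of odd discriminant `−D_K < −4` with `𝒪_K/𝔑 ≃ ℤ/Nℤ`, under (i), "(ii) if `2` is
nonsplit in `K`, then `2 ∥ N`", (iii), (iv): "`X` and `𝔖_p` both have `Λ`-rank one with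
`char_Λ(X_tors) = char_Λ(𝔖_p/Λκ_∞^*)²`", `κ_∞^*` the `Λ`-adic Heegner class or — at a SPLIT
multiplicative `p`, where `pr_0(κ_∞) = 0` (Thm. 2.1, exceptional zero) — its derivative `κ_∞'`,
`κ_∞ = (γ−1)κ_∞'`), which "is based on an extension of the 'explicit reciprocity law' of
[cas-hsieh1] to the multiplicative case" (Thm. 2.2) and is "deduce[d] … from the cases of the
Iwasawa Main Conjecture for `L_𝔭(f)` proved in [cas-CJM] and [cas-CJM-err]" = the paper's Thm. 3.1
= the tree's OPEN hypothesis `Castella2018.erratumThm11_exists_isBDPLFunction_isTorsion_charIdeal_eq_OPEN` /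
`…erratum_thmAprime…_OPEN` (`Castella2018/AnticyclotomicMainConjectureErratum.lean`: the erratum's
proof invokes Fouquet–Wan arXiv:2107.13726 Thm. 4.41, itself unrefereed); "Finally, the proof of
Theorem 1.1 is deduced by an application of Theorem 1.3 for a carefully chosen `K` together with a
variant of Mazur's control theorem" (Thm. 3.4, at `p ∥ N` split in `K`, from [greenberg-cetraro] and
`log_p(q_E) ≠ 0` [BSDGG]). Theorems 1.3 / 2.1 / 2.2 are NOT transcribed here: their objects (the
regularized Heegner classes `z_m` of `p`-power conductor at a prime `p ∣ N`, eq. (2.2); the derived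
class `κ_∞'`; the big logarithm `𝓛̃_𝔭` at a multiplicative `p`) have no tree vocabulary today (the
tree's `HeegnerModuleIndex` / `Howard2004_thmB` frame is written at `p ∤ N`) — recorded as typed GAPS
on the cell's faithfulness sheet, not weakened into something statable.

RELATION TO PRIOR MULTIPLICATIVE `p`-CONVERSES (the paper's §1.2, `[ibid. p0004:L8]`, verbatim):
"Earlier results … are due to Skinner–Zhang [skinner-zhang] and independently Venerucci
[venerucci-conv] … The result of [skinner-zhang] … requires additional ramification hypotheses on
`E[p]` …; while the main result of [venerucci-conv] is subject to the hypothesis that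
`#Ш(E/ℚ)[p^∞] < ∞` (but, compared to Theorem 1.1, allows both `E(ℚ_p)[p] ≠ 0`, and `E` to have
split multiplicative reduction at the prime `q ∥ N`, with `q ≠ p`, where `E[p]` is required to
ramify)." In the tree: `SkinnerZhang2014.thm1_1_rank_one_of_selmerCorank_eq_one_OPEN` (hypotheses
(a)–(e) incl. `p ∤ ord_p(Δ)`, two primes `ℓ ∥ N` with `p ∤ ord_ℓ(Δ)`); Venerucci, Invent. Math. 203
(2016) is not a tree binder. Theorem 1.1 is thus a DIFFERENT hypothesis set for the same conclusion —
useful to the multiplicative leg of the `h9` binder of `bsz_rankLeOne_cRank_of_pieces`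
(`LeadingTermBSZRankOneMultiplicativeLegProofs.lean`) only with its «literal-PRE» label.

## Transcription (word for word → tree predicate; binders (i)–(iii) are those of
`Castella2018.erratum_thmAprime_padicVal_bsd_rankOne_OPEN`, same author, same wording)

* "`E/ℚ` an elliptic curve" — a globally minimal Weierstrass model `W/ℚ` (`[W.IsGloballyMinimal]`,
  to read `Δ_min` and the reduction types off the model); "`p > 3`" — `5 ≤ p`;
  "multiplicative reduction at `p`" — `W.HasMultiplicativeReductionAtPrime p`.
* (i) — `W.HasIrreducibleModPGaloisRep p`.
* (ii) "nonsplit multiplicative reduction at some prime `q ≠ p` where `E[p]` is ramified" —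
  `∃ q` prime, `q ≠ p`, `W.HasMultiplicativeReductionAtPrime q ∧ ¬ W.HasSplitMultiplicativeReductionAtPrime q`
  and `¬ p ∣ v_q(Δ_min)` ("`E[p]` ramified at a multiplicative `q ≠ p`" ⟺ `p ∤ ord_q(Δ_min)` by
  Tate's parametrisation, resp. its unramified quadratic twist — the erratum file's reading and
  bsd.S30's binder `haux`).
* (iii) "`E(ℚ_p)[p] = 0`" — every `ℚ_p`-point of `W` killed by `p` is `0` (on `W.baseChange ℚ_[p]`;
  the group `E(ℚ_p)` is model-independent).
* "`corank_{ℤ_p} Sel_{p^∞}(E/ℚ) = 1`" — `W.selmerCorank p = 1` (`Selmer.lean`, as in every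
  `p`-converse binder of the tree); conclusions "`ord_{s=1} L(E,s) = 1`, and so `rank_ℤ E(ℚ) = 1`
  and `#Ш(E/ℚ) < ∞`" — `W.analyticRank = 1 ∧ W.mordellWeilRank = 1 ∧ Finite W.sha` (all three
  printed; the last two are Gross–Zagier–Kolyvagin consequences of the first, printed as part of the
  statement and therefore transcribed, as in the Skinner–Zhang binder).
* Cor. 1.2: "`Sel_p(E/ℚ)` has order `p`" — `Nat.card (W.selmerGroup p) = p` (the `p`-Selmer group
  in `H¹(ℚ,E[p])`, `Selmer.lean`); its printed proof ingredient "the alternating Cassels–Tate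
  pairing" — the tree's named fact `exists_casselsTate_pairing` (binder `hCT`), through the tree
  THEOREM `selmerCorank_eq_one_of_card_selmerGroup_eq_of_hasIrreducibleModPGaloisRep`
  (`#Sel_p = p` and `E[p]` irreducible ⟹ corank `1`). Nothing is weakened or strengthened; no
  hypothesis is dropped or added.
-/

noncomputable section

open scoped Classical

open WeierstrassCurve

namespace Literature.NumberTheory.EllipticCurves.Castella2024

/-- **Hypotheses (i)–(iii) of Castella, arXiv:2409.01360v1, Theorem 1.1** at a prime `p` for a
globally minimal `W/ℚ`, bundled (word for word, module docstring «Transcription»): (i) `E[p]`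
irreducible; (ii) a prime `q ≠ p` of NONSPLIT multiplicative reduction at which `E[p]` is ramified
(`p ∤ v_q(Δ_min)`); (iii) `E(ℚ_p)[p] = 0`. The same three binders, unbundled, are the hypotheses of
`Castella2018.erratum_thmAprime_padicVal_bsd_rankOne_OPEN` (`Hypotheses.erratum_binders` below).
A predicate; nothing asserted. [claim: Castella2024, status: under-review] -/
structure Hypotheses (W : WeierstrassCurve ℚ) [W.IsGloballyMinimal] (p : ℕ) [Fact p.Prime] : Prop where
  /-- (i) `E[p]` is an irreducible `G_ℚ`-module. -/
  irr : W.HasIrreducibleModPGaloisRep p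
  /-- (ii) some prime `q ≠ p` of nonsplit multiplicative reduction at which `E[p]` is ramified. -/
  nonsplit_ramified : ∃ (q : ℕ) (_ : Fact q.Prime), q ≠ p ∧ W.HasMultiplicativeReductionAtPrime q ∧
    ¬ W.HasSplitMultiplicativeReductionAtPrime q ∧ ¬ p ∣ padicValInt q W.minimalDiscriminantInt
  /-- (iii) `E(ℚ_p)[p] = 0`. -/
  no_local_pTorsion : ∀ P : (W.baseChange ℚ_[p]).toAffine.Point, p • P = 0 → P = 0

/-- **OPEN HYPOTHESIS — UNREFEREED PREPRINT (arXiv:2409.01360v1, 2 Sep 2024; no journal version as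
of August 2026).** Castella, *Exceptional zeros for Heegner points and `p`-converse to the theorem of
Gross–Zagier and Kolyvagin*, **Theorem 1.1** (§1.1; store `paper:arxiv-2409.01360` chunk p0003
L7–L20): "Let `E/ℚ` be an elliptic curve with multiplicative reduction at the prime `p > 3`. Assume
that (i) `E[p]` is irreducible as a `G_ℚ`-module, (ii) `E` has nonsplit multiplicative reduction at
some prime `q ≠ p` where `E[p]` is ramified, (iii) `E(ℚ_p)[p] = 0`. Then
`corank_{ℤ_p} Sel_{p^∞}(E/ℚ) = 1 ⟹ ord_{s=1} L(E,s) = 1`, and so `rank_ℤ E(ℚ) = 1` and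
`#Ш(E/ℚ) < ∞`." Transcribed with `5 ≤ p`, `W.HasMultiplicativeReductionAtPrime p`, (i)–(iii) =
`Hypotheses W p`, premise `W.selmerCorank p = 1`, conclusions
`W.analyticRank = 1 ∧ W.mordellWeilRank = 1 ∧ Finite W.sha`. Printed proof: via the paper's
Thm. 1.3 (Heegner point main variant with a derived class at split `p`), Thm. 2.2 (explicit
reciprocity law at `p ∥ N`), Thm. 3.1 (= Castella's Camb. J. Math. erratum Thm. 1.1, tree
`Castella2018.…_OPEN`, resting on Fouquet–Wan arXiv:2107.13726 Thm. 4.41) and the control Thm. 3.4.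
NEVER cite this `Prop` as a theorem: take it as an explicit hypothesis
`(hC : Castella2024.thm11_analyticRank_eq_one_of_selmerCorank_eq_one_OPEN)`; a result using it is
conditional on an unrefereed claim («literal-PRE»). [claim: Castella2024, status: under-review] -/
def thm11_analyticRank_eq_one_of_selmerCorank_eq_one_OPEN : Prop :=
  ∀ (W : WeierstrassCurve ℚ) [W.IsElliptic] [W.IsGloballyMinimal] (p : ℕ) [Fact p.Prime],
    5 ≤ p → W.HasMultiplicativeReductionAtPrime p → Hypotheses W p → W.selmerCorank p = 1 →
    W.analyticRank = 1 ∧ W.mordellWeilRank = 1 ∧ Finite W.sha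

variable (W : WeierstrassCurve ℚ) [W.IsElliptic] [W.IsGloballyMinimal] (p : ℕ) [Fact p.Prime]

omit [W.IsElliptic] in
/-- The bundled hypotheses ARE the three unbundled binders `hirr`, `hq`, `htors` of
`Castella2018.erratum_thmAprime_padicVal_bsd_rankOne_OPEN` (same author, same wording), so one check
feeds both the `p`-converse (this file) and the rank-one `p`-part (the erratum binder).
[claim: Castella2024, status: under-review] -/
theorem Hypotheses.erratum_binders (h : Hypotheses W p) :
    W.HasIrreducibleModPGaloisRep p ∧
    (∃ (q : ℕ) (_ : Fact q.Prime), q ≠ p ∧ W.HasMultiplicativeReductionAtPrime q ∧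
      ¬ W.HasSplitMultiplicativeReductionAtPrime q ∧ ¬ p ∣ padicValInt q W.minimalDiscriminantInt) ∧
    (∀ P : (W.baseChange ℚ_[p]).toAffine.Point, p • P = 0 → P = 0) :=
  ⟨h.irr, h.nonsplit_ramified, h.no_local_pTorsion⟩

/-- Reading of the claim in the shape the `p`-converse consumers use (`selmerCorank p = 1 →
analyticRank = 1`), CONDITIONAL on the open hypothesis `hC`. [claim: Castella2024, status: under-review] -/
theorem analyticRank_eq_one_of_thm11_OPEN (hC : thm11_analyticRank_eq_one_of_selmerCorank_eq_one_OPEN)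
    (hp : 5 ≤ p) (hmult : W.HasMultiplicativeReductionAtPrime p) (hH : Hypotheses W p)
    (hsel : W.selmerCorank p = 1) : W.analyticRank = 1 :=
  (hC W p hp hmult hH hsel).1

/-- "and so `rank_ℤ E(ℚ) = 1` and `#Ш(E/ℚ) < ∞`" (second and third printed conclusions),
CONDITIONAL on `hC`. [claim: Castella2024, status: under-review] -/
theorem rank_eq_one_and_finite_sha_of_thm11_OPEN
    (hC : thm11_analyticRank_eq_one_of_selmerCorank_eq_one_OPEN)
    (hp : 5 ≤ p) (hmult : W.HasMultiplicativeReductionAtPrime p) (hH : Hypotheses W p)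
    (hsel : W.selmerCorank p = 1) : W.mordellWeilRank = 1 ∧ Finite W.sha :=
  (hC W p hp hmult hH hsel).2

/-- **Castella, arXiv:2409.01360v1, Corollary 1.2, DERIVED (not vendored)** — "Let `E/ℚ` be an
elliptic curve with multiplicative reduction at the prime `p > 3` satisfying conditions (i)–(iii) in
Theorem 1.1. If the `p`-Selmer group `Sel_p(E/ℚ) ⊂ H¹(ℚ,E[p])` has order `p`, then
`rank_ℤ E(ℚ) = ord_{s=1} L(E,s) = 1` and `#Ш(E/ℚ) < ∞`", whose printed proof is "immediate from
Theorem 1.1 and the existence of the alternating Cassels–Tate pairing": here from the OPEN hypothesis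
`hC` and the tree's Cassels–Tate fact `hCT`, through the tree THEOREM
`selmerCorank_eq_one_of_card_selmerGroup_eq_of_hasIrreducibleModPGaloisRep` (`#Sel_p = p` and (i)
⟹ `E(ℚ)[p] = 0` ⟹ corank `1`). CONDITIONAL on an unrefereed claim. [claim: Castella2024, status: under-review] -/
theorem cor12_rank_eq_analyticRank_eq_one_of_card_selmerGroup_eq_of_thm11_OPEN
    (hC : thm11_analyticRank_eq_one_of_selmerCorank_eq_one_OPEN)
    (hCT : exists_casselsTate_pairing (K := ℚ))
    (hp : 5 ≤ p) (hmult : W.HasMultiplicativeReductionAtPrime p) (hH : Hypotheses W p)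
    (hSel : Nat.card (W.selmerGroup p) = p) :
    W.mordellWeilRank = 1 ∧ W.analyticRank = 1 ∧ Finite W.sha := by
  have hsel : W.selmerCorank p = 1 :=
    selmerCorank_eq_one_of_card_selmerGroup_eq_of_hasIrreducibleModPGaloisRep hCT W p hH.irr hSel
  obtain ⟨han, hrk, hfin⟩ := hC W p hp hmult hH hsel
  exact ⟨hrk, han, hfin⟩

end Literature.NumberTheory.EllipticCurves.Castella2024

end
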